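import Summits.QuantumFields.YangMills.Theorems.UnitScaleGibbsActionDerivativeGaussianDomination
import Summits.QuantumFields.YangMills.Theorems.UnitScaleGibbsMGFTwoLevelDomination
import Mathlib.Probability.Moments.SubGaussian
import HarnessLib

/-!
# `X_u = ∂_u A` under Bałaban's Gibbs measure: Mathlib's `HasSubgaussianMGF` currency, and the TWO-LEVEL variance bound
# `∫ X_u² dμ_β ≤ (K_G + K(u)·μ_β(Gᶜ)) ∕ β` from an on-event Hessian bound `|actionDeriv₂| ≤ K_G` on `G`

Crux of record `UnitScaleTilt.HistoryTailL` (stmt-QuantumFields-19936), cell `ym3-torus` (YM ladder rung R3 = continuum SU(2) Yang–Mills on T³ — a RUNG, NOT the Clay problem);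
width seat `ym3-torus-px17` gen 7.  Two doors on ✓∕⧗ `UnitScaleGibbsActionDerivativeGaussianDomination` (Gross's Gaussian domination for `X_u`, matrix model and `SU(N)`) and
✓ `UnitScaleGibbsMGFTwoLevelDomination` (the two-level assembly from a black-box Schwinger–Dyson identity):

* §1 ★★ `hasSubgaussianMGF_of_rows` (abstract gauge group, the rows of ✓ `UnitScaleGibbsSchwingerDysonGaussianDomination`) and ★★ `su_hasSubgaussianMGF_actionDeriv` —
  `ProbabilityTheory.HasSubgaussianMGF (actionDeriv (fundamentalRep (Fin N)) u) ⟨K(u)∕β⟩ (gibbsMeasure P β)`: the `SU(N)` statement in MATHLIB'S CURRENCY (so Mathlib's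
  sub-Gaussian toolkit — tails, sums of independent copies, Hoeffding-type lemmas — applies verbatim; the `U(1)` twin is px8 g9's `U1TorusFluxSubgaussianMGF`);
* §2 ★★★ `integral_sq_le_twoLevel_of_rows` (abstract gauge group, fixed directions): with the rows of FILE 1 and an ON-EVENT bound `|Σ_i X′ i| ≤ K_G` on a measurable `G`,
  `∫ X² dμ_β ≤ (K_G + K·δ)∕β` whenever `μ_β(Gᶜ) ≤ δ` — ✓ `integral_sq_le_of_sd_twoLevel` fed with ✓ `schwingerDyson_identity` and ✓ `integral_eq_zero`;
  ★★★ `su_integral_actionDeriv_sq_le_twoLevel` — the `SU(N)` instance: `|actionDeriv₂ (fundamentalRep (Fin N)) u| ≤ K_G` on `G` ⟹ `∫ X_u² dμ_β ≤ (K_G + hessianBound u·δ)∕β`.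
  (In LINE 28's C3 the identity is the TREE-CONDITIONAL one for the gauge-fixed observable, not the fixed-direction one — that instance plugs into
  ✓ `integral_sq_le_of_sd_twoLevel` directly; this file records the fixed-direction reading, which is what a gauge-INVARIANT choice of `u`-observable would use.)

HONEST SCOPE.  Doors; the on-event bound and the event mass are HYPOTHESES; nothing of (A)∕(A3′)∕`stub_condSD`∕(E), «ShallowFluxSecondMomentL», «BlockSecondMomentL», (Q), K1,
`MeanDeviationL`, `HistoryTailL`, R3, d = 4, a continuum limit or a mass gap is proved; LINE 28 is an idea, not a registered line; the Yang–Mills mass gap is NOT proved.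
THEOREMS ONLY (0 `def`, 0 `sorry`); `--supports stmt-QuantumFields-19936 --as helper`.

References: L. Gross, CMP 92 (1983) 137–162, Thm 2.2 [GrossCMP1983]; S. Boucheron, G. Lugosi, P. Massart, Concentration Inequalities (2013) §2.3 [BoucheronLugosiMassart2013].
-/

set_option autoImplicit false

noncomputable section

open MeasureTheory Set Filter Topology NormedSpace ProbabilityTheory
open scoped BigOperators NNReal
open Literature.MathematicalPhysics.QuantumFieldTheory.Balaban1983to89
open Literature.MathematicalPhysics.QuantumFieldTheory.Balaban1983to89.T4GenFunBounds (gibbsMeasure isProbabilityMeasure_gibbsMeasure)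
open Literature.MathematicalPhysics.QuantumLattice (fundamentalRep fundamentalRep_mem_unitaryGroup continuous_fundamentalRep)
open Summit.QuantumFields.YangMills.Theorems.UnitScaleGibbsMGFSecondMoment (integrable_of_abs_le)
open Summit.QuantumFields.YangMills.Theorems.UnitScaleGibbsActionDerivativeSlotCalculus
open Summit.QuantumFields.YangMills.Theorems.UnitScaleGibbsSchwingerDysonGaussianDomination
open Summit.QuantumFields.YangMills.Theorems.UnitScaleGibbsMGFTwoLevelDomination (integral_sq_le_of_sd_twoLevel)
open Summit.QuantumFields.YangMills.Theorems.UnitScaleGibbsActionDerivativeGaussianDomination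

namespace Summit.QuantumFields.YangMills.Theorems.UnitScaleGibbsActionDerivativeSubgaussian

/-! ## §1 Mathlib's `HasSubgaussianMGF` currency -/

section Abstract

variable {P : Params} [DecidableEq (PBond P 0)] {G : Type} [GaugeGroup G] [MeasurableSpace G] [RegularGaugeGroup G] [HaarData G]
variable {ι : Type} [Fintype ι]

/-- ★★ **THE ABSTRACT THEOREM IN MATHLIB'S CURRENCY**: under the rows of ✓ `UnitScaleGibbsSchwingerDysonGaussianDomination` (fixed directions, `X = Σ_i A′ i`,
`|Σ_i X′ i| ≤ K`, `β > 0`), `X` `HasSubgaussianMGF` with parameter `K∕β` under `gibbsMeasure P β`. [cite: GrossCMP1983, Thm 2.2; BoucheronLugosiMassart2013, §2.3] -/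
theorem hasSubgaussianMGF_of_rows {β : ℝ} (hβ : 0 < β)
    (b : ι → PBond P 0) (k : ι → ℝ → G) (hk : ∀ i s t, k i (s + t) = k i s * k i t)
    (A' : ι → GaugeField P 0 G → ℝ) (hA'm : ∀ i, Measurable (A' i)) (hA'b : ∀ i, ∃ C, ∀ U, |A' i U| ≤ C)
    (hA' : ∀ i U, HasDerivAt (fun t => wilsonAction4 (Function.update U (b i) (k i t * U (b i)))) (A' i U) 0)
    (X : GaugeField P 0 G → ℝ) (hX : ∀ U, X U = ∑ i, A' i U)
    (X' : ι → GaugeField P 0 G → ℝ) (hX'm : ∀ i, Measurable (X' i)) (hX'b : ∀ i, ∃ C, ∀ U, |X' i U| ≤ C)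
    (hX' : ∀ i U, HasDerivAt (fun t => X (Function.update U (b i) (k i t * U (b i)))) (X' i U) 0)
    {K : ℝ} (hK : ∀ U, |∑ i, X' i U| ≤ K) :
    HasSubgaussianMGF X ⟨K / β, div_nonneg (nonneg_of_hessianBound X' hK) hβ.le⟩ (gibbsMeasure (G := G) P β) := by
  haveI := isProbabilityMeasure_gibbsMeasure (G := G) P hβ.le
  have hXm : Measurable X := measurable_of_eq_sum A' hA'm X hX
  obtain ⟨B, -, hXB⟩ := exists_abs_le_of_eq_sum A' hA'b X hX
  refine ⟨fun t => ?_, fun t => ?_⟩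
  · refine integrable_of_abs_le _ (measurable_const.mul hXm).exp (C := Real.exp (|t| * B)) fun U => ?_
    rw [abs_of_pos (Real.exp_pos _)]
    refine Real.exp_le_exp.2 ?_
    calc t * X U ≤ |t * X U| := le_abs_self _
      _ = |t| * |X U| := abs_mul _ _
      _ ≤ |t| * B := mul_le_mul_of_nonneg_left (hXB U) (abs_nonneg _)
  · calc mgf X (gibbsMeasure (G := G) P β) t = ∫ U, Real.exp (t * X U) ∂gibbsMeasure P β := rfl
      _ ≤ Real.exp (K * t ^ 2 / (2 * β)) := integral_exp_mul_le hβ b k hk A' hA'm hA'b hA' X hX X' hX'm hX'b hX' hK t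
      _ = Real.exp (((⟨K / β, div_nonneg (nonneg_of_hessianBound X' hK) hβ.le⟩ : ℝ≥0) : ℝ) * t ^ 2 / 2) := by
          have hc : ((⟨K / β, div_nonneg (nonneg_of_hessianBound X' hK) hβ.le⟩ : ℝ≥0) : ℝ) = K / β := rfl
          rw [hc]; congr 1; field_simp

/-! ## §2 The two-level variance bound for fixed directions -/

/-- ★★★ **THE TWO-LEVEL VARIANCE BOUND, FIXED DIRECTIONS**: under the rows of FILE 1 (`β > 0`), if moreover `|Σ_i X′ i| ≤ K_G` on a measurable event `G` with
`μ_β(Gᶜ) ≤ δ` (`0 ≤ K_G`), then `∫ X² dμ_β ≤ (K_G + K·δ)∕β` — the on-event constant plus the off-event mass times the crude constant.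
(✓ `integral_sq_le_of_sd_twoLevel` at `c = β` with ✓ `schwingerDyson_identity` and ✓ `integral_eq_zero`.) [cite: GrossCMP1983, Thm 2.2; BoucheronLugosiMassart2013, §2.3] -/
theorem integral_sq_le_twoLevel_of_rows {β : ℝ} (hβ : 0 < β)
    (b : ι → PBond P 0) (k : ι → ℝ → G) (hk : ∀ i s t, k i (s + t) = k i s * k i t)
    (A' : ι → GaugeField P 0 G → ℝ) (hA'm : ∀ i, Measurable (A' i)) (hA'b : ∀ i, ∃ C, ∀ U, |A' i U| ≤ C)
    (hA' : ∀ i U, HasDerivAt (fun t => wilsonAction4 (Function.update U (b i) (k i t * U (b i)))) (A' i U) 0)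
    (X : GaugeField P 0 G → ℝ) (hX : ∀ U, X U = ∑ i, A' i U)
    (X' : ι → GaugeField P 0 G → ℝ) (hX'm : ∀ i, Measurable (X' i)) (hX'b : ∀ i, ∃ C, ∀ U, |X' i U| ≤ C)
    (hX' : ∀ i U, HasDerivAt (fun t => X (Function.update U (b i) (k i t * U (b i)))) (X' i U) 0)
    {K : ℝ} (hK : ∀ U, |∑ i, X' i U| ≤ K)
    {Gset : Set (GaugeField P 0 G)} (hG : MeasurableSet Gset) {KG : ℝ} (hKG : 0 ≤ KG) (hYG : ∀ U ∈ Gset, |∑ i, X' i U| ≤ KG)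
    {δ : ℝ} (hδ : (gibbsMeasure (G := G) P β).real Gsetᶜ ≤ δ) :
    ∫ U, X U ^ 2 ∂gibbsMeasure P β ≤ (KG + K * δ) / β := by
  haveI := isProbabilityMeasure_gibbsMeasure (G := G) P hβ.le
  have hXm : Measurable X := measurable_of_eq_sum A' hA'm X hX
  obtain ⟨B, -, hXB⟩ := exists_abs_le_of_eq_sum A' hA'b X hX
  have hYm : Measurable (fun U => ∑ i, X' i U) := Finset.measurable_sum _ fun i _ => hX'm i
  exact integral_sq_le_of_sd_twoLevel (gibbsMeasure (G := G) P β) hXm hYm hXB hK (nonneg_of_hessianBound X' hK) hG hYG hKG hδ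
    (integral_eq_zero hβ b k hk A' hA'm hA'b hA' X hX) hβ
    (fun s => schwingerDyson_identity hβ.le b k hk A' hA'm hA'b hA' X hX X' hX'm hX'b hX' s)

end Abstract

/-! ## §3 The `SU(N)` instances -/

section SpecialUnitary

variable {N : ℕ} [NeZero N] {P : Params} [DecidableEq (PBond P 0)]
  (u : PBond P 0 → Matrix (Fin N) (Fin N) ℂ) (hus : ∀ b, star (u b) = -u b) (hu0 : ∀ b, (u b).trace = 0)

include hus hu0

/-- ★★ **`X_u` `HasSubgaussianMGF` WITH PARAMETER `K(u)∕β` UNDER `gibbsMeasure P β` ON `SU(N)`** (`β > 0`; every torus; `u` skew-Hermitian traceless, U-independent).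
[cite: GrossCMP1983, Thm 2.2; BoucheronLugosiMassart2013, §2.3] -/
theorem su_hasSubgaussianMGF_actionDeriv {β : ℝ} (hβ : 0 < β) :
    HasSubgaussianMGF (actionDeriv (fundamentalRep (Fin N)) u) ⟨hessianBound u / β, div_nonneg (hessianBound_nonneg u) hβ.le⟩
      (gibbsMeasure (G := Matrix.specialUnitaryGroup (Fin N) ℂ) P β) := by
  haveI : SecondCountableTopology (Matrix.specialUnitaryGroup (Fin N) ℂ) := by
    haveI := secondCountableTopology_matrix (n := Fin N)
    exact Topology.IsEmbedding.subtypeVal.secondCountableTopology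
  haveI := isProbabilityMeasure_gibbsMeasure (G := Matrix.specialUnitaryGroup (Fin N) ℂ) P hβ.le
  obtain ⟨hre, k, hk, hkX⟩ := su_data (P := P) u hus hu0
  obtain ⟨h1, h2, h3, h4, -, -, -, -⟩ := rows (continuous_fundamentalRep (Fin N)) hre fundamentalRep_mem_unitaryGroup u hk hkX
  have hXm : Measurable (actionDeriv (fundamentalRep (Fin N)) u) := measurable_of_eq_sum _ h1 _ h4
  obtain ⟨B, -, hXB⟩ := exists_abs_le_of_eq_sum _ h2 _ h4
  refine ⟨fun t => ?_, fun t => ?_⟩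
  · refine integrable_of_abs_le _ (measurable_const.mul hXm).exp (C := Real.exp (|t| * B)) fun U => ?_
    rw [abs_of_pos (Real.exp_pos _)]
    refine Real.exp_le_exp.2 ?_
    calc t * actionDeriv (fundamentalRep (Fin N)) u U ≤ |t * actionDeriv (fundamentalRep (Fin N)) u U| := le_abs_self _
      _ = |t| * |actionDeriv (fundamentalRep (Fin N)) u U| := abs_mul _ _
      _ ≤ |t| * B := mul_le_mul_of_nonneg_left (hXB U) (abs_nonneg _)
  · calc mgf (actionDeriv (fundamentalRep (Fin N)) u) (gibbsMeasure P β) t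
        = ∫ U, Real.exp (t * actionDeriv (fundamentalRep (Fin N)) u U) ∂gibbsMeasure P β := rfl
      _ ≤ Real.exp (hessianBound u * t ^ 2 / (2 * β)) := su_integral_exp_mul_actionDeriv_le u hus hu0 hβ t
      _ = Real.exp (((⟨hessianBound u / β, div_nonneg (hessianBound_nonneg u) hβ.le⟩ : ℝ≥0) : ℝ) * t ^ 2 / 2) := by
          have hc : ((⟨hessianBound u / β, div_nonneg (hessianBound_nonneg u) hβ.le⟩ : ℝ≥0) : ℝ) = hessianBound u / β := rfl
          rw [hc]; congr 1; field_simp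

/-- ★★★ **THE TWO-LEVEL VARIANCE BOUND FOR `X_u` ON `SU(N)`**: if the summed Hessian `actionDeriv₂ (fundamentalRep (Fin N)) u` is bounded by `K_G ≥ 0` on a measurable event
`G` with `μ_β(Gᶜ) ≤ δ`, then `∫ X_u² dμ_β ≤ (K_G + hessianBound u·δ)∕β` — on-event constant plus crude constant times off-event mass.
[cite: GrossCMP1983, Thm 2.2; BoucheronLugosiMassart2013, §2.3] -/
theorem su_integral_actionDeriv_sq_le_twoLevel {β : ℝ} (hβ : 0 < β)
    {Gset : Set (GaugeField P 0 (Matrix.specialUnitaryGroup (Fin N) ℂ))} (hG : MeasurableSet Gset) {KG : ℝ} (hKG : 0 ≤ KG)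
    (hYG : ∀ U ∈ Gset, |actionDeriv₂ (fundamentalRep (Fin N)) u U| ≤ KG) {δ : ℝ}
    (hδ : (gibbsMeasure (G := Matrix.specialUnitaryGroup (Fin N) ℂ) P β).real Gsetᶜ ≤ δ) :
    ∫ U, actionDeriv (fundamentalRep (Fin N)) u U ^ 2 ∂gibbsMeasure P β ≤ (KG + hessianBound u * δ) / β := by
  haveI : SecondCountableTopology (Matrix.specialUnitaryGroup (Fin N) ℂ) := by
    haveI := secondCountableTopology_matrix (n := Fin N)
    exact Topology.IsEmbedding.subtypeVal.secondCountableTopology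
  obtain ⟨hre, k, hk, hkX⟩ := su_data (P := P) u hus hu0
  obtain ⟨h1, h2, h3, h4, h5, h6, h7, h8⟩ := rows (continuous_fundamentalRep (Fin N)) hre fundamentalRep_mem_unitaryGroup u hk hkX
  have hYG' : ∀ U ∈ Gset, |∑ b, oneBondDeriv₂ (fundamentalRep (Fin N)) u b U| ≤ KG := fun U hU => by
    rw [sum_oneBondDeriv₂]; exact hYG U hU
  exact integral_sq_le_twoLevel_of_rows hβ (fun b => b) k hk _ h1 h2 h3 _ h4 _ h5 h6 h7 h8 hG hKG hYG' hδ

end SpecialUnitary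

end Summit.QuantumFields.YangMills.Theorems.UnitScaleGibbsActionDerivativeSubgaussian

end
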